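import Literature.MathematicalPhysics.KineticTheory.HardSphereEulerProofs
import Summits.AtomisticToContinuum.HydrodynamicLimit.Theorems.JaynesSqueezeHardSphereLDAEos
import HarnessLib

/-!
# Hard-sphere local density approximation, V: the linear density path and its Stieltjes sums

Helper file for the support item `HardSphereLDA` (stmt-AtomisticToContinuum-13459) of route
`JaynesSqueeze`. The free energy of the inhomogeneous gas at the thermodynamic activity
`α_σ(ρ) = ρ e^{g_σ(ρ)}` of a continuous unit-mass density `ρ` is reached from the uniform gas along
the LINEAR DENSITY PATH `ρ_t = (1 − t) + t ρ` (`t = k/m`), every member of which is again a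
continuous positive unit-mass density in the same packing band (`pathNode_*`). Along the path the
field increments are `ψ_k = h_σ(ρ_{(k+1)/m}) − h_σ(ρ_{k/m})` (`h_σ = log + g_σ`, file II), and the two
Riemann–Stieltjes sums `∑_k ∫ ψ_k ρ_{k/m}`, `∑_k ∫ ψ_k ρ_{(k+1)/m}` which sandwich the free-energy
increment (file IV) both converge, as `m → ∞`, to

  `∫ [Ψ_σ(ρ) − Ψ_σ(1)] dx`,  `Ψ_σ(r) = r + v_σ(r)`,  `Ψ_σ′ = r h_σ′`

(`abs_sum_lower_sub_le`, `abs_sum_upper_sub_le`: rate `K (sup|ρ − 1|)² / m`, by the pointwise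
Stieltjes remainder `abs_stieltjes_remainder_le` of file II and telescoping).
No definitions (the path and the increments are written out). prover-pitem-stmt-AtomisticToContinuum-13459-0.
-/

noncomputable section

namespace Summit.AtomisticToContinuum.HydrodynamicLimit.Theorems.HardSphereLDA

open MeasureTheory Filter Set Topology
open Literature.MathematicalPhysics.KineticTheory Literature.Analysis.FluidPDE

/-! ### The linear density path -/

/-- The path parameter `τ_k = min (k/m) 1 ∈ [0, 1]`. [folklore] -/
theorem pathParam_mem (m k : ℕ) : min ((k : ℝ) / m) 1 ∈ Icc (0 : ℝ) 1 :=
  ⟨le_min (by positivity) zero_le_one, min_le_right _ _⟩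

/-- Consecutive path parameters differ by `1/m` before the end: for `k < m` (`m ≥ 1`),
`τ_{k+1} − τ_k = 1/m`. [folklore] -/
theorem pathParam_succ_sub {m k : ℕ} (hk : k < m) :
    min (((k + 1 : ℕ) : ℝ) / m) 1 - min ((k : ℝ) / m) 1 = 1 / m := by
  have hm : (0 : ℝ) < m := by exact_mod_cast (Nat.zero_le k).trans_lt hk
  have h1 : ((k + 1 : ℕ) : ℝ) / m ≤ 1 := by
    rw [div_le_one hm]; exact_mod_cast hk
  have h2 : (k : ℝ) / m ≤ 1 := by
    rw [div_le_one hm]; exact_mod_cast hk.le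
  rw [min_eq_left h1, min_eq_left h2, Nat.cast_succ]
  field_simp
  ring

variable {ρ : T3 → ℝ}

/-- **Path nodes are admissible densities.** For a continuous `ρ > 0` of unit mass with
`r_lo ≤ ρ ≤ r_hi` (`r_lo ≤ 1 ≤ r_hi`) and `τ ∈ [0, 1]`, the node `x ↦ (1 − τ) + τ ρ(x)` is continuous,
lies in `[r_lo, r_hi]`, is positive and has unit mass. [folklore] -/
theorem pathNode_spec (hρc : Continuous ρ) (hρ1 : (∫ x, ρ x) = 1) {rlo rhi : ℝ} (hlo : 0 < rlo)
    (hlo1 : rlo ≤ 1) (hhi1 : 1 ≤ rhi) (hρlo : ∀ x, rlo ≤ ρ x) (hρhi : ∀ x, ρ x ≤ rhi)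
    {τ : ℝ} (hτ : τ ∈ Icc (0 : ℝ) 1) :
    Continuous (fun x => (1 - τ) + τ * ρ x) ∧ (∀ x, rlo ≤ (1 - τ) + τ * ρ x) ∧
      (∀ x, (1 - τ) + τ * ρ x ≤ rhi) ∧ (∀ x, 0 < (1 - τ) + τ * ρ x) ∧
      (∫ x, (1 - τ) + τ * ρ x) = 1 := by
  have hc : Continuous (fun x => (1 - τ) + τ * ρ x) := continuous_const.add (continuous_const.mul hρc)
  have hlo' : ∀ x, rlo ≤ (1 - τ) + τ * ρ x := fun x => by nlinarith [hρlo x, hτ.1, hτ.2]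
  refine ⟨hc, hlo', fun x => by nlinarith [hρhi x, hτ.1, hτ.2], fun x => hlo.trans_le (hlo' x), ?_⟩
  rw [integral_add (integrable_const _) ((integrable_of_continuous_T3 hρc).const_mul τ), integral_const_mul,
    hρ1, integral_const, smul_eq_mul, probReal_univ]
  ring

/-- **Packing along the path**: if `σ³ ≤ η` and `ρσ³ ≤ η` then every node has packing `≤ η`. [folklore] -/
theorem pathNode_packing {σ η : ℝ} (hση : σ ^ 3 ≤ η) (hρη : ∀ x, ρ x * σ ^ 3 ≤ η)
    {τ : ℝ} (hτ : τ ∈ Icc (0 : ℝ) 1) (x : T3) : ((1 - τ) + τ * ρ x) * σ ^ 3 ≤ η := by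
  have h := hρη x
  nlinarith [hτ.1, hτ.2]

/-! ### The Stieltjes sums along the path -/

/-- **Pointwise lower Stieltjes sum.** Along real nodes `r_k = (1 − τ_k) + τ_k r₁`, `τ_k = min(k/m) 1`
(so `r₀ = 1`, `r_m = r₁`), if `h′ = k`, `Ψ′(s) = s k(s)` and `|k| ≤ K` on `[[1, r₁]]`, then
`|∑_{k<m} r_k (h r_{k+1} − h r_k) − (Ψ r₁ − Ψ 1)| ≤ K (r₁ − 1)² / m`. [folklore] -/
theorem abs_lowerSum_sub_le {h Ψ k : ℝ → ℝ} {K r₁ : ℝ}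
    (hh : ∀ s ∈ uIcc 1 r₁, HasDerivAt h (k s) s) (hΨ : ∀ s ∈ uIcc 1 r₁, HasDerivAt Ψ (s * k s) s)
    (hK : ∀ s ∈ uIcc 1 r₁, |k s| ≤ K) {m : ℕ} (hm : 0 < m) :
    |(∑ j ∈ Finset.range m,
        ((1 - min ((j : ℝ) / m) 1) + min ((j : ℝ) / m) 1 * r₁) *
          (h ((1 - min (((j + 1 : ℕ) : ℝ) / m) 1) + min (((j + 1 : ℕ) : ℝ) / m) 1 * r₁) -
            h ((1 - min ((j : ℝ) / m) 1) + min ((j : ℝ) / m) 1 * r₁))) - (Ψ r₁ - Ψ 1)| ≤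
      K * (r₁ - 1) ^ 2 / m := by
  set node : ℕ → ℝ := fun j => (1 - min ((j : ℝ) / m) 1) + min ((j : ℝ) / m) 1 * r₁ with hnode
  have hm0 : (0 : ℝ) < m := by exact_mod_cast hm
  have hK0 : 0 ≤ K := (abs_nonneg _).trans (hK 1 left_mem_uIcc)
  -- nodes lie in the segment `[[1, r₁]]`
  have hmem : ∀ j, node j ∈ uIcc 1 r₁ := by
    intro j
    have hτ := pathParam_mem m j
    rcases le_total 1 r₁ with h1 | h1
    · rw [uIcc_of_le h1]; exact ⟨by rw [hnode]; nlinarith [hτ.1, hτ.2], by rw [hnode]; nlinarith [hτ.1, hτ.2]⟩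
    · rw [uIcc_of_ge h1]; exact ⟨by rw [hnode]; nlinarith [hτ.1, hτ.2], by rw [hnode]; nlinarith [hτ.1, hτ.2]⟩
  have hnode0 : node 0 = 1 := by simp [hnode]
  have hnodem : node m = r₁ := by
    rw [hnode]; dsimp only
    rw [div_self hm0.ne', min_self]; ring
  have hstep : ∀ j, j < m → node (j + 1) - node j = (r₁ - 1) / m := by
    intro j hj
    have h := pathParam_succ_sub hj
    rw [hnode]; dsimp only
    have : (1 - min (((j + 1 : ℕ) : ℝ) / m) 1) + min (((j + 1 : ℕ) : ℝ) / m) 1 * r₁ -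
        ((1 - min ((j : ℝ) / m) 1) + min ((j : ℝ) / m) 1 * r₁) =
        (min (((j + 1 : ℕ) : ℝ) / m) 1 - min ((j : ℝ) / m) 1) * (r₁ - 1) := by ring
    rw [Nat.cast_succ] at this ⊢
    rw [this]
    rw [Nat.cast_succ] at h
    rw [h]; ring
  -- telescoping of `Ψ`
  have htel : Ψ r₁ - Ψ 1 = ∑ j ∈ Finset.range m, (Ψ (node (j + 1)) - Ψ (node j)) := by
    rw [Finset.sum_range_sub (fun j => Ψ (node j)), hnodem, hnode0]
  -- termwise Stieltjes remainders
  have hterm : ∀ j ∈ Finset.range m,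
      |node j * (h (node (j + 1)) - h (node j)) - (Ψ (node (j + 1)) - Ψ (node j))| ≤
        K * ((r₁ - 1) / m) ^ 2 := by
    intro j hj
    have hj' := Finset.mem_range.1 hj
    have hsub : uIcc (node j) (node (j + 1)) ⊆ uIcc 1 r₁ := uIcc_subset_uIcc (hmem j) (hmem (j + 1))
    have hrem := abs_stieltjes_remainder_le (fun s hs => hh s (hsub hs)) (fun s hs => hΨ s (hsub hs))
      (fun s hs => hK s (hsub hs))
    rw [hstep j hj'] at hrem
    rw [abs_sub_comm]
    calc |Ψ (node (j + 1)) - Ψ (node j) - node j * (h (node (j + 1)) - h (node j))| ≤ K * ((r₁ - 1) / m) ^ 2 := hrem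
      _ = K * ((r₁ - 1) / m) ^ 2 := rfl
  have hcast : ∀ j : ℕ, (((j + 1 : ℕ) : ℝ)) = (j : ℝ) + 1 := fun j => by push_cast; ring
  calc |(∑ j ∈ Finset.range m, node j * (h (node (j + 1)) - h (node j))) - (Ψ r₁ - Ψ 1)|
      = |∑ j ∈ Finset.range m, (node j * (h (node (j + 1)) - h (node j)) - (Ψ (node (j + 1)) - Ψ (node j)))| := by
        rw [htel, ← Finset.sum_sub_distrib]
    _ ≤ ∑ j ∈ Finset.range m, |node j * (h (node (j + 1)) - h (node j)) - (Ψ (node (j + 1)) - Ψ (node j))| :=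
        Finset.abs_sum_le_sum_abs _ _
    _ ≤ ∑ _j ∈ Finset.range m, K * ((r₁ - 1) / m) ^ 2 := Finset.sum_le_sum hterm
    _ = K * (r₁ - 1) ^ 2 / m := by
        rw [Finset.sum_const, Finset.card_range, nsmul_eq_mul]
        field_simp

/-- **Pointwise upper Stieltjes sum**: with `r_{k+1}` in place of `r_k` as the weight, the same
limit with error `2K (r₁ − 1)²/m` (the field increments are `K`-Lipschitz in the node). [folklore] -/
theorem abs_upperSum_sub_le {h Ψ k : ℝ → ℝ} {K r₁ : ℝ}
    (hh : ∀ s ∈ uIcc 1 r₁, HasDerivAt h (k s) s) (hΨ : ∀ s ∈ uIcc 1 r₁, HasDerivAt Ψ (s * k s) s)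
    (hK : ∀ s ∈ uIcc 1 r₁, |k s| ≤ K) {m : ℕ} (hm : 0 < m) :
    |(∑ j ∈ Finset.range m,
        ((1 - min (((j + 1 : ℕ) : ℝ) / m) 1) + min (((j + 1 : ℕ) : ℝ) / m) 1 * r₁) *
          (h ((1 - min (((j + 1 : ℕ) : ℝ) / m) 1) + min (((j + 1 : ℕ) : ℝ) / m) 1 * r₁) -
            h ((1 - min ((j : ℝ) / m) 1) + min ((j : ℝ) / m) 1 * r₁))) - (Ψ r₁ - Ψ 1)| ≤
      2 * K * (r₁ - 1) ^ 2 / m := by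
  set node : ℕ → ℝ := fun j => (1 - min ((j : ℝ) / m) 1) + min ((j : ℝ) / m) 1 * r₁ with hnode
  have hm0 : (0 : ℝ) < m := by exact_mod_cast hm
  have hK0 : 0 ≤ K := (abs_nonneg _).trans (hK 1 left_mem_uIcc)
  have hmem : ∀ j, node j ∈ uIcc 1 r₁ := by
    intro j
    have hτ := pathParam_mem m j
    rcases le_total 1 r₁ with h1 | h1
    · rw [uIcc_of_le h1]; exact ⟨by rw [hnode]; nlinarith [hτ.1, hτ.2], by rw [hnode]; nlinarith [hτ.1, hτ.2]⟩
    · rw [uIcc_of_ge h1]; exact ⟨by rw [hnode]; nlinarith [hτ.1, hτ.2], by rw [hnode]; nlinarith [hτ.1, hτ.2]⟩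
  have hstep : ∀ j, j < m → node (j + 1) - node j = (r₁ - 1) / m := by
    intro j hj
    have h := pathParam_succ_sub hj
    rw [hnode]; dsimp only
    have : (1 - min (((j + 1 : ℕ) : ℝ) / m) 1) + min (((j + 1 : ℕ) : ℝ) / m) 1 * r₁ -
        ((1 - min ((j : ℝ) / m) 1) + min ((j : ℝ) / m) 1 * r₁) =
        (min (((j + 1 : ℕ) : ℝ) / m) 1 - min ((j : ℝ) / m) 1) * (r₁ - 1) := by ring
    rw [Nat.cast_succ] at this ⊢
    rw [this]
    rw [Nat.cast_succ] at h
    rw [h]; ring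
  -- the lower sum bound
  have hlow := abs_lowerSum_sub_le hh hΨ hK hm
  -- the field increments are `K`-Lipschitz
  have hlip : ∀ j ∈ Finset.range m, |h (node (j + 1)) - h (node j)| ≤ K * |(r₁ - 1) / m| := by
    intro j hj
    have hj' := Finset.mem_range.1 hj
    have hsub : uIcc (node j) (node (j + 1)) ⊆ uIcc 1 r₁ := uIcc_subset_uIcc (hmem j) (hmem (j + 1))
    have hmv := Convex.norm_image_sub_le_of_norm_hasDerivWithin_le (f := h) (f' := k)
      (s := uIcc (node j) (node (j + 1))) (C := K) (fun s hs => (hh s (hsub hs)).hasDerivWithinAt)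
      (fun s hs => by rw [Real.norm_eq_abs]; exact hK s (hsub hs)) (convex_uIcc _ _) left_mem_uIcc right_mem_uIcc
    rw [Real.norm_eq_abs, Real.norm_eq_abs, hstep j hj'] at hmv
    exact hmv
  -- the difference of the two sums
  have hdiff : |∑ j ∈ Finset.range m, (node (j + 1) - node j) * (h (node (j + 1)) - h (node j))| ≤
      K * (r₁ - 1) ^ 2 / m := by
    calc |∑ j ∈ Finset.range m, (node (j + 1) - node j) * (h (node (j + 1)) - h (node j))|
        ≤ ∑ j ∈ Finset.range m, |(node (j + 1) - node j) * (h (node (j + 1)) - h (node j))| :=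
          Finset.abs_sum_le_sum_abs _ _
      _ ≤ ∑ _j ∈ Finset.range m, |(r₁ - 1) / m| * (K * |(r₁ - 1) / m|) := by
          refine Finset.sum_le_sum fun j hj => ?_
          rw [abs_mul, hstep j (Finset.mem_range.1 hj)]
          exact mul_le_mul_of_nonneg_left (hlip j hj) (abs_nonneg _)
      _ = K * (r₁ - 1) ^ 2 / m := by
          rw [Finset.sum_const, Finset.card_range, nsmul_eq_mul, abs_div, abs_of_pos hm0]
          field_simp
          rw [sq_abs]
  have hsplit : (∑ j ∈ Finset.range m, node (j + 1) * (h (node (j + 1)) - h (node j))) =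
      (∑ j ∈ Finset.range m, node j * (h (node (j + 1)) - h (node j))) +
        ∑ j ∈ Finset.range m, (node (j + 1) - node j) * (h (node (j + 1)) - h (node j)) := by
    rw [← Finset.sum_add_distrib]
    refine Finset.sum_congr rfl fun j _ => by ring
  have hcastnode : ∀ j : ℕ, node (j + 1) = (1 - min (((j + 1 : ℕ) : ℝ) / m) 1) + min (((j + 1 : ℕ) : ℝ) / m) 1 * r₁ := by
    intro j; rw [hnode]
  simp only [← hcastnode]
  rw [hsplit]
  calc |(∑ j ∈ Finset.range m, node j * (h (node (j + 1)) - h (node j))) +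
        (∑ j ∈ Finset.range m, (node (j + 1) - node j) * (h (node (j + 1)) - h (node j))) - (Ψ r₁ - Ψ 1)|
      = |((∑ j ∈ Finset.range m, node j * (h (node (j + 1)) - h (node j))) - (Ψ r₁ - Ψ 1)) +
          ∑ j ∈ Finset.range m, (node (j + 1) - node j) * (h (node (j + 1)) - h (node j))| := by ring_nf
    _ ≤ |(∑ j ∈ Finset.range m, node j * (h (node (j + 1)) - h (node j))) - (Ψ r₁ - Ψ 1)| +
          |∑ j ∈ Finset.range m, (node (j + 1) - node j) * (h (node (j + 1)) - h (node j))| := abs_add_le _ _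
    _ ≤ K * (r₁ - 1) ^ 2 / m + K * (r₁ - 1) ^ 2 / m := add_le_add hlow hdiff
    _ = 2 * K * (r₁ - 1) ^ 2 / m := by ring

end Summit.AtomisticToContinuum.HydrodynamicLimit.Theorems.HardSphereLDA

end
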